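import Literature.NumberTheory.LFunctions.MontgomeryOdlyzkoCriterionProofs
import Literature.NumberTheory.LFunctions.SchoenfeldZeroSumsExplicit
import HarnessLib

/-!
# The second moment of the sharp eta vector at the zeros, zero side II: Abel summation over the
# ordinates and one pair of dual frequencies
(route EtaLeadingQuarter, item `EtaLeadingSecondMoment`, stmt-RiemannHypothesis-21791)

`γ_n = zetaOrdinate n`, `N(T) = zetaZeroCount T`. The squared dual sum at height `t` with cutoff
`y = ⌊t/(πM)⌋` is `‖∑_{k odd ≤ y} k^{-1/2-it}‖² = ∑_{k odd ≤ y} 1/k + OFF(y, t)`,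
`OFF(y,t) = ∑_{j ≠ k odd ≤ y} (jk)^{-1/2} cos(t (log k − log j))`. The off-diagonal is controlled,
pair by pair, by Landau's formula for the cosine sums `∑_{n<N(U)} cos(γ_n log x)` (under RH: tree
`MontgomeryOdlyzko.exists_abs_cosSum_add_le`, `MontgomeryOdlyzko.abs_cosSum_sub_add_le`):

* `sum_filter_mul_inv_sq_le` — Abel summation over the ordinates: if `A(t) − A(T₁') ≤ R` on
  `[T₁', T₂]` for `A(t) = ∑_{n<N(t)} c_n`, then `∑_{n<N(T₂), γ_n ≥ T₁} c_n/γ_n² ≤ R/T₁'²`;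
* `pair_le` — for `1 ≤ j < k`, `kπM ≤ T₂`:
  `∑_{n<N(T₂), γ_n ≥ kπM} cos(γ_n (log k − log j))/γ_n² ≤ C·R(j,k,T₂)/(kπM − 1)²` (the main terms
  `−Λ(k/j)…` of Landau's formula are `≤ 0` and dropped);
* `pair_le'` — the same in the symmetric form `(jk)^{-1/2}·(…) ≤ (5C(1+log T₂)²/(2M²))/(jk)`.

The sum over all pairs is in part III (`EtaLeadingQuarterSecondMomentZerosOffDiag`). RH enters only
through the hypothesis `hLG`; nothing here bears on the truth of RH.
-/

noncomputable section

open Finset Filter Topology MeasureTheory intervalIntegral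
open scoped Real

set_option linter.dupNamespace false  -- the mandated namespace repeats `RiemannHypothesis`

namespace Summit.RiemannHypothesis.RiemannHypothesis.Theorems.EtaLeadingQuarter.Zeros

open Literature.NumberTheory.LFunctions SchoenfeldBound

/-! ## Abel summation over the ordinates -/

/-- For `T₁' ≤ t`: the indices `n < N(T₂)` with `T₁ ≤ γ_n ≤ t` are `[N(T₁'), N(t))` when there is no
ordinate in `(T₁', T₁)` and `t ≤ T₂`. [folklore] -/
theorem filter_filter_eq_sdiff {T₁' T₁ T₂ t : ℝ} (ht2 : t ≤ T₂)
    (hgap : ∀ n, zetaOrdinate n ≤ T₁' ↔ zetaOrdinate n < T₁) :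
    ((Finset.range (zetaZeroCount T₂)).filter (fun n ↦ T₁ ≤ zetaOrdinate n)).filter
        (fun n ↦ zetaOrdinate n ≤ t) =
      Finset.range (zetaZeroCount t) \ Finset.range (zetaZeroCount T₁') := by
  ext n
  simp only [Finset.mem_filter, Finset.mem_range, Finset.mem_sdiff, ← Montgomery.zetaOrdinate_le_iff_lt]
  constructor
  · rintro ⟨⟨-, h2⟩, h3⟩
    exact ⟨h3, fun h ↦ absurd ((hgap n).1 h) (not_lt.2 h2)⟩
  · rintro ⟨h1, h2⟩
    refine ⟨⟨h1.trans ht2, ?_⟩, h1⟩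
    by_contra hlt
    exact h2 ((hgap n).2 (not_le.1 hlt))

/-- **Abel summation over the ordinates, one-sided.** Let `0 < T₁' < T₁ ≤ T₂` with no ordinate in
`(T₁', T₁)`, `c : ℕ → ℝ`, `A(t) = ∑_{n<N(t)} c_n`, and suppose `A(t) − A(T₁') ≤ R` for
`T₁' ≤ t ≤ T₂`. Then `∑_{n<N(T₂), γ_n ≥ T₁} c_n/γ_n² ≤ R/T₁'²`
(`1/γ² = 1/T₂² + ∫_γ^{T₂} 2/u³`, swap sum and integral). [folklore] -/
theorem sum_filter_mul_inv_sq_le (c : ℕ → ℝ) {T₁' T₁ T₂ R : ℝ} (h0 : 0 < T₁') (h1 : T₁' < T₁)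
    (h12 : T₁ ≤ T₂) (hgap : ∀ n, zetaOrdinate n ≤ T₁' ↔ zetaOrdinate n < T₁)
    (hA : ∀ t : ℝ, T₁' ≤ t → t ≤ T₂ →
      ∑ n ∈ Finset.range (zetaZeroCount t), c n - ∑ n ∈ Finset.range (zetaZeroCount T₁'), c n ≤ R) :
    ∑ n ∈ (Finset.range (zetaZeroCount T₂)).filter (fun n ↦ T₁ ≤ zetaOrdinate n),
        c n / zetaOrdinate n ^ 2 ≤ R / T₁' ^ 2 := by
  classical
  set S := (Finset.range (zetaZeroCount T₂)).filter (fun n ↦ T₁ ≤ zetaOrdinate n) with hS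
  set A : ℝ → ℝ := fun t ↦ ∑ n ∈ Finset.range (zetaZeroCount t), c n with hAdef
  have h12' : T₁' ≤ T₂ := h1.le.trans h12
  have hmemS : ∀ n ∈ S, T₁' < zetaOrdinate n ∧ zetaOrdinate n ≤ T₂ := by
    intro n hn
    rw [hS, Finset.mem_filter, Finset.mem_range] at hn
    exact ⟨h1.trans_le hn.2, Montgomery.zetaOrdinate_le_iff_lt.2 hn.1⟩
  -- the partial sums of `S` are `A(t) - A(T₁')`
  have hpart : ∀ t : ℝ, T₁' ≤ t → t ≤ T₂ →
      ∑ n ∈ S, (if zetaOrdinate n ≤ t then c n else 0) = A t - A T₁' := by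
    intro t ht1 ht2
    rw [← Finset.sum_filter, hS, filter_filter_eq_sdiff ht2 hgap, Finset.sum_sdiff_eq_sub]
    exact Finset.range_subset_range.2 (zetaZeroCount_mono ht1)
  -- `1/γ² = 1/T₂² + ∫_{T₁'}^{T₂} 1_{γ ≤ u} 2/u³`
  have hg : ContinuousOn (fun u : ℝ ↦ 2 / u ^ 3) (Set.Icc T₁' T₂) :=
    continuousOn_of_forall_continuousAt fun u hu ↦ by
      have : u ≠ 0 := by linarith [hu.1]
      exact ContinuousAt.div continuousAt_const (continuousAt_pow u 3) (by positivity)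
  have hone : ∀ n ∈ S, 1 / zetaOrdinate n ^ 2 =
      1 / T₂ ^ 2 + ∫ u in T₁'..T₂, (if zetaOrdinate n ≤ u then (1 : ℝ) else 0) * (2 / u ^ 3) := by
    intro n hn
    obtain ⟨hn1, hn2⟩ := hmemS n hn
    rw [integral_indicator_mul_eq hn1 hn2 hg]
    have hderiv : ∀ u ∈ Set.uIcc (zetaOrdinate n) T₂, HasDerivAt (fun y : ℝ ↦ -(y ^ 2)⁻¹) (2 / u ^ 3) u := by
      intro u hu
      rw [Set.uIcc_of_le hn2] at hu
      have hu0 : u ≠ 0 := by linarith [hu.1]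
      have := (hasDerivAt_inv_sq hu0).neg
      refine this.congr_deriv ?_
      ring
    have hint : IntervalIntegrable (fun u : ℝ ↦ 2 / u ^ 3) volume (zetaOrdinate n) T₂ :=
      (hg.mono (Set.Icc_subset_Icc hn1.le le_rfl)).intervalIntegrable_of_Icc hn2
    rw [integral_eq_sub_of_hasDerivAt hderiv hint]
    have : zetaOrdinate n ≠ 0 := by linarith
    have : T₂ ≠ 0 := by linarith
    field_simp
    ring
  -- interval integrability of the pieces
  have hint : ∀ n ∈ S, IntervalIntegrable
      (fun u ↦ c n * ((if zetaOrdinate n ≤ u then (1 : ℝ) else 0) * (2 / u ^ 3))) volume T₁' T₂ := by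
    intro n _
    have hg' : IntegrableOn (fun u : ℝ ↦ 2 / u ^ 3) (Set.Ioc T₁' T₂) volume :=
      hg.integrableOn_Icc.mono_set Set.Ioc_subset_Icc_self
    have heq : (fun u ↦ (if zetaOrdinate n ≤ u then (1 : ℝ) else 0) * (2 / u ^ 3)) =
        (Set.Ici (zetaOrdinate n)).indicator (fun u : ℝ ↦ 2 / u ^ 3) := by
      funext u
      by_cases h : zetaOrdinate n ≤ u
      · rw [if_pos h, one_mul, Set.indicator_of_mem (show u ∈ Set.Ici (zetaOrdinate n) from h)]
      · rw [if_neg h, zero_mul, Set.indicator_of_notMem (show u ∉ Set.Ici (zetaOrdinate n) from h)]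
    refine IntervalIntegrable.const_mul ?_ _
    rw [intervalIntegrable_iff_integrableOn_Ioc_of_le h12', heq]
    exact hg'.indicator measurableSet_Ici
  -- the identity
  have hid : ∑ n ∈ S, c n / zetaOrdinate n ^ 2 =
      (A T₂ - A T₁') / T₂ ^ 2 +
        ∫ u in T₁'..T₂, (∑ n ∈ S, (if zetaOrdinate n ≤ u then c n else 0)) * (2 / u ^ 3) := by
    calc ∑ n ∈ S, c n / zetaOrdinate n ^ 2
        = ∑ n ∈ S, (c n * (1 / T₂ ^ 2) +
            ∫ u in T₁'..T₂, c n * ((if zetaOrdinate n ≤ u then (1 : ℝ) else 0) * (2 / u ^ 3))) := by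
          refine Finset.sum_congr rfl fun n hn ↦ ?_
          rw [div_eq_mul_one_div, hone n hn, mul_add, intervalIntegral.integral_const_mul]
      _ = (∑ n ∈ S, c n) * (1 / T₂ ^ 2) +
            ∫ u in T₁'..T₂, ∑ n ∈ S, c n * ((if zetaOrdinate n ≤ u then (1 : ℝ) else 0) * (2 / u ^ 3)) := by
          rw [Finset.sum_add_distrib, Finset.sum_mul, intervalIntegral.integral_finsetSum hint]
      _ = (A T₂ - A T₁') / T₂ ^ 2 +
            ∫ u in T₁'..T₂, (∑ n ∈ S, (if zetaOrdinate n ≤ u then c n else 0)) * (2 / u ^ 3) := by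
          have e : ∑ n ∈ S, c n = A T₂ - A T₁' := by
            rw [← hpart T₂ h12' le_rfl]
            refine Finset.sum_congr rfl fun n hn ↦ ?_
            rw [if_pos (hmemS n hn).2]
          rw [e, mul_one_div]
          congr 1
          refine intervalIntegral.integral_congr fun u _ ↦ ?_
          rw [Finset.sum_mul]
          refine Finset.sum_congr rfl fun n _ ↦ ?_
          split_ifs <;> ring
  rw [hid]
  -- bound the two pieces
  have hT2 : 0 < T₂ := h0.trans_le h12'
  have hb1 : (A T₂ - A T₁') / T₂ ^ 2 ≤ R / T₂ ^ 2 :=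
    div_le_div_of_nonneg_right (hA T₂ h12' le_rfl) (by positivity)
  have hb2 : ∫ u in T₁'..T₂, (∑ n ∈ S, (if zetaOrdinate n ≤ u then c n else 0)) * (2 / u ^ 3) ≤
      ∫ u in T₁'..T₂, R * (2 / u ^ 3) := by
    refine intervalIntegral.integral_mono_on h12' ?_ ?_ fun u hu ↦ ?_
    · have : (fun u ↦ (∑ n ∈ S, (if zetaOrdinate n ≤ u then c n else 0)) * (2 / u ^ 3)) =
          fun u ↦ ∑ n ∈ S, c n * ((if zetaOrdinate n ≤ u then (1 : ℝ) else 0) * (2 / u ^ 3)) := by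
        funext u
        rw [Finset.sum_mul]
        refine Finset.sum_congr rfl fun n _ ↦ ?_
        split_ifs <;> ring
      rw [this]
      have hs := IntervalIntegrable.sum S hint
      rw [Finset.sum_fn] at hs
      exact hs
    · exact (hg.intervalIntegrable_of_Icc h12').const_mul R
    · rw [hpart u hu.1 hu.2]
      have h3 : 0 ≤ 2 / u ^ 3 := by
        have : 0 < u := h0.trans_le hu.1
        positivity
      exact mul_le_mul_of_nonneg_right (hA u hu.1 hu.2) h3
  have hI : ∫ u in T₁'..T₂, R * (2 / u ^ 3) = R * (1 / T₁' ^ 2 - 1 / T₂ ^ 2) := by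
    rw [intervalIntegral.integral_const_mul]
    congr 1
    have hderiv : ∀ u ∈ Set.uIcc T₁' T₂, HasDerivAt (fun y : ℝ ↦ -(y ^ 2)⁻¹) (2 / u ^ 3) u := by
      intro u hu
      rw [Set.uIcc_of_le h12'] at hu
      have hu0 : u ≠ 0 := by linarith [hu.1]
      exact ((hasDerivAt_inv_sq hu0).neg).congr_deriv (by ring)
    rw [integral_eq_sub_of_hasDerivAt hderiv (hg.intervalIntegrable_of_Icc h12')]
    have : T₁' ≠ 0 := h0.ne'
    have : T₂ ≠ 0 := hT2.ne'
    field_simp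
    ring
  rw [hI] at hb2
  have : R / T₂ ^ 2 + R * (1 / T₁' ^ 2 - 1 / T₂ ^ 2) = R / T₁' ^ 2 := by ring
  linarith

/-! ## One pair of dual frequencies -/

/-- A height just below `T₁`, above which `γ_n < T₁` already forces `γ_n ≤` it (the ordinates below
`T₁` form a discrete set). [folklore] -/
theorem exists_height_below {T₁ : ℝ} :
    ∃ T₁' : ℝ, T₁ - 1 ≤ T₁' ∧ T₁' < T₁ ∧ ∀ n, zetaOrdinate n ≤ T₁' ↔ zetaOrdinate n < T₁ := by
  obtain ⟨ε, hε, hgap⟩ := Montgomery.exists_gap_below T₁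
  refine ⟨T₁ - min ε 1, by linarith [min_le_right ε 1], by linarith [lt_min hε one_pos], fun n ↦ ⟨fun h ↦ ?_, fun h ↦ ?_⟩⟩
  · linarith [lt_min hε one_pos]
  · have := (Montgomery.zetaOrdinate_lt_iff_le_sub hε hgap n).1 h
    linarith [min_le_left ε 1]

/-- `log 3 ≤ 2`. [folklore] -/
theorem log_three_le_two : Real.log 3 ≤ 2 := by
  rw [Real.log_le_iff_le_exp (by norm_num)]
  have h := Real.exp_one_gt_d9
  have : Real.exp 2 = Real.exp 1 * Real.exp 1 := by rw [← Real.exp_add]; norm_num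
  nlinarith

/-- **One pair, under Landau's formula.** For `1 ≤ j < k`, `M ≥ 1`, `kπM ≤ T₂` and the cosine-sum
form of Landau's formula (hypothesis `hLG`, = `MontgomeryOdlyzko.exists_abs_cosSum_add_le` under RH):
`∑_{n<N(T₂), γ_n ≥ kπM} cos(γ_n (log k − log j))/γ_n²`
`  ≤ C (√(k/j) (k/(k−j)) (2(log² T₂ + log(1+k)) + log²(3k)) + log(3k) √(jk)) / (kπM − 1)²`
(the main term `−(t − T₁')Λ(k/j)√(j/k)/2π ≤ 0` is dropped). [folklore] -/
theorem pair_le {C : ℝ} (hC : 0 ≤ C)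
    (hLG : ∀ x : ℝ, 1 < x → ∀ U : ℝ, 2 ≤ U →
      |2 * Real.sqrt x * (∑ n ∈ Finset.range (zetaZeroCount U), Real.cos (zetaOrdinate n * (Real.log x))) +
          U / π * (if ((⌊x⌋₊ : ℕ) : ℝ) = x then ArithmeticFunction.vonMangoldt ⌊x⌋₊ else 0)| ≤
        C * (x * (Real.log U ^ 2 + Real.log (1 + 1 / Real.log x)) * (1 + 1 / Real.log x) +
          x * Real.log (3 * x) ^ 2 + Real.log (3 * x) * min U (x / primePowDist x)))
    {j k : ℕ} (hj : 1 ≤ j) (hjk : j < k) {M : ℕ} (hM : 1 ≤ M) {T₂ : ℝ}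
    (hkT : (k : ℝ) * (π * M) ≤ T₂) :
    ∑ n ∈ (Finset.range (zetaZeroCount T₂)).filter (fun n ↦ (k : ℝ) * (π * M) ≤ zetaOrdinate n),
        Real.cos (zetaOrdinate n * (Real.log k - Real.log j)) / zetaOrdinate n ^ 2 ≤
      C * (Real.sqrt ((k : ℝ) / j) * ((k : ℝ) / ((k : ℝ) - j)) *
          (2 * (Real.log T₂ ^ 2 + Real.log (1 + k)) + Real.log (3 * k) ^ 2) +
        Real.log (3 * k) * Real.sqrt ((j : ℝ) * k)) / ((k : ℝ) * (π * M) - 1) ^ 2 := by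
  have hπ := Real.pi_gt_three
  have hM1 : (1 : ℝ) ≤ M := by exact_mod_cast hM
  have hk2 : (2 : ℝ) ≤ k := by exact_mod_cast (show 2 ≤ k by omega)
  have hk0 : (0 : ℝ) < k := by linarith
  have hj0 : (0 : ℝ) < j := by exact_mod_cast hj
  have hπM3 : 3 ≤ π * (M : ℝ) := by nlinarith
  set T₁ : ℝ := (k : ℝ) * (π * M) with hT₁
  have hT₁ : 3 * (k : ℝ) ≤ T₁ := by
    rw [hT₁]; nlinarith [mul_le_mul_of_nonneg_left hπM3 hk0.le]
  obtain ⟨T₁', hlo, hlt, hgap⟩ := exists_height_below (T₁ := T₁)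
  have hT₁'2 : 2 ≤ T₁' := by linarith
  have hkT₁' : (k : ℝ) ≤ T₁' := by linarith
  set R : ℝ := C * (Real.sqrt ((k : ℝ) / j) * ((k : ℝ) / ((k : ℝ) - j)) *
      (2 * (Real.log T₂ ^ 2 + Real.log (1 + k)) + Real.log (3 * k) ^ 2) +
    Real.log (3 * k) * Real.sqrt ((j : ℝ) * k)) with hR
  -- the Landau input: `A(t) - A(T₁') ≤ R` on `[T₁', T₂]`
  have hA : ∀ t : ℝ, T₁' ≤ t → t ≤ T₂ →
      ∑ n ∈ Finset.range (zetaZeroCount t), Real.cos (zetaOrdinate n * (Real.log k - Real.log j)) -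
        ∑ n ∈ Finset.range (zetaZeroCount T₁'), Real.cos (zetaOrdinate n * (Real.log k - Real.log j)) ≤ R := by
    intro t ht1 ht2
    have h := MontgomeryOdlyzko.abs_cosSum_sub_add_le hC hLG hT₁'2 ht1 (y := k) hj hjk le_rfl
      (hkT₁'.trans ht1)
    have hmain : 0 ≤ (t - T₁') / (2 * π) *
        ((if j ∣ k then ArithmeticFunction.vonMangoldt (k / j) else 0) * Real.sqrt ((j : ℝ) / k)) := by
      have h1 : 0 ≤ (if j ∣ k then ArithmeticFunction.vonMangoldt (k / j) else 0) := by
        split_ifs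
        · exact ArithmeticFunction.vonMangoldt_nonneg
        · exact le_rfl
      have h2 : 0 ≤ t - T₁' := by linarith
      positivity
    have hlogt : Real.log t ^ 2 ≤ Real.log T₂ ^ 2 := by
      have h1 : 0 ≤ Real.log t := Real.log_nonneg (by linarith)
      exact pow_le_pow_left₀ h1 (Real.log_le_log (by linarith) ht2) 2
    have hmono : C * (Real.sqrt ((k : ℝ) / j) * ((k : ℝ) / ((k : ℝ) - j)) *
          (2 * (Real.log t ^ 2 + Real.log (1 + k)) + Real.log (3 * k) ^ 2) +
        Real.log (3 * k) * Real.sqrt ((j : ℝ) * k)) ≤ R := by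
      rw [hR]
      have hkj : 0 < (k : ℝ) - j := by
        have : (j : ℝ) + 1 ≤ k := by exact_mod_cast hjk
        linarith
      have h0 : 0 ≤ Real.sqrt ((k : ℝ) / j) * ((k : ℝ) / ((k : ℝ) - j)) := by positivity
      gcongr
    have habs := (abs_le.1 h).2
    linarith
  have h := sum_filter_mul_inv_sq_le (fun n ↦ Real.cos (zetaOrdinate n * (Real.log k - Real.log j)))
    (by linarith) hlt hkT hgap hA
  refine h.trans ?_
  have hR0 : 0 ≤ R := by
    rw [hR]
    have hkj : 0 < (k : ℝ) - j := by
      have : (j : ℝ) + 1 ≤ k := by exact_mod_cast hjk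
      linarith
    have : 0 ≤ Real.log (1 + (k : ℝ)) := Real.log_nonneg (by linarith)
    have : 0 ≤ Real.log (3 * (k : ℝ)) := Real.log_nonneg (by linarith)
    positivity
  have hden : 0 < T₁ - 1 := by linarith
  exact div_le_div_of_nonneg_left hR0 (by positivity) (pow_le_pow_left₀ hden.le hlo 2)

/-- Pure algebra for one pair: with `w = 1/(√j√k)`, `D ≥ 2kM`, `k − j ≥ 1`, `P, ℓ ≥ 0`,
`P + ℓ ≤ 10L²`: `w · C (√(k/j) (k/(k−j)) P + ℓ √(jk)) / D² ≤ (5CL²/(2M²)) / (jk)`. [folklore] -/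
theorem pair_algebra {C P ℓ L D Mr j k : ℝ} (hC : 0 ≤ C) (hP : 0 ≤ P) (hℓ : 0 ≤ ℓ) (hj : 1 ≤ j)
    (hkj : 1 ≤ k - j) (hM : 1 ≤ Mr) (hD : 2 * (k * Mr) ≤ D) (hPL : P + ℓ ≤ 10 * L ^ 2) :
    1 / (Real.sqrt j * Real.sqrt k) * (C * (Real.sqrt (k / j) * (k / (k - j)) * P + ℓ * Real.sqrt (j * k)) / D ^ 2) ≤
      5 * C * L ^ 2 / (2 * Mr ^ 2) * (1 / (j * k)) := by
  have hj0 : 0 < j := by linarith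
  have hk0 : 0 < k := by linarith
  have hsj0 : 0 < Real.sqrt j := Real.sqrt_pos.2 hj0
  have hsk0 : 0 < Real.sqrt k := Real.sqrt_pos.2 hk0
  have hsq : Real.sqrt (k / j) = Real.sqrt k / Real.sqrt j := Real.sqrt_div' _ hj0.le
  have hsq2 : Real.sqrt (j * k) = Real.sqrt j * Real.sqrt k := Real.sqrt_mul hj0.le _
  have hsj : Real.sqrt j ^ 2 = j := Real.sq_sqrt hj0.le
  have hD0 : 0 < D := by nlinarith
  -- `w · (C (...)) / D² = C Q / D²`, `Q = (k/(k−j)) P / j + ℓ`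
  have e1 : 1 / (Real.sqrt j * Real.sqrt k) * (C * (Real.sqrt (k / j) * (k / (k - j)) * P + ℓ * Real.sqrt (j * k)) / D ^ 2) =
      C * ((k / (k - j)) * P / j + ℓ) / D ^ 2 := by
    rw [hsq, hsq2]
    field_simp
    rw [hsj]
    ring
  rw [e1]
  -- `Q ≤ (k/j) · 10 L²`
  have hkj0 : 0 < k - j := by linarith
  have hQ : (k / (k - j)) * P / j + ℓ ≤ (k / j) * (10 * L ^ 2) := by
    have h1 : (k / (k - j)) * P / j ≤ (k / j) * P := by
      rw [div_mul_eq_mul_div, div_div, div_le_iff₀ (by positivity)]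
      have : k / j * P * ((k - j) * j) = k * P * (k - j) := by field_simp
      rw [this]
      nlinarith [mul_nonneg (mul_nonneg hk0.le hP) (by linarith : (0 : ℝ) ≤ k - j - 1)]
    have h2 : ℓ ≤ (k / j) * ℓ := by
      have : 1 ≤ k / j := by rw [le_div_iff₀ hj0]; linarith
      nlinarith
    nlinarith [mul_le_mul_of_nonneg_left hPL (by positivity : (0 : ℝ) ≤ k / j)]
  -- `D² ≥ 4 k² M²`
  have hD2 : 4 * (k * Mr) ^ 2 ≤ D ^ 2 := by
    calc 4 * (k * Mr) ^ 2 = (2 * (k * Mr)) ^ 2 := by ring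
      _ ≤ D ^ 2 := pow_le_pow_left₀ (by positivity) hD 2
  calc C * ((k / (k - j)) * P / j + ℓ) / D ^ 2
      ≤ C * ((k / j) * (10 * L ^ 2)) / D ^ 2 := by gcongr
    _ ≤ C * ((k / j) * (10 * L ^ 2)) / (4 * (k * Mr) ^ 2) :=
        div_le_div_of_nonneg_left (by positivity) (by positivity) hD2
    _ = 5 * C * L ^ 2 / (2 * Mr ^ 2) * (1 / (j * k)) := by
        field_simp
        ring

/-- **One ordered pair, symmetric final form.** For `1 ≤ j < k ≤ T₂/(πM)`, `M ≥ 1`, `T₂ ≥ 1`,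
`L = 1 + log T₂`: `(jk)^{-1/2} ∑_{n<N(T₂), γ_n ≥ kπM} cos(γ_n(log k − log j))/γ_n² ≤ (5CL²/(2M²))/(jk)`.
[folklore] -/
theorem pair_le' {C : ℝ} (hC : 0 ≤ C)
    (hLG : ∀ x : ℝ, 1 < x → ∀ U : ℝ, 2 ≤ U →
      |2 * Real.sqrt x * (∑ n ∈ Finset.range (zetaZeroCount U), Real.cos (zetaOrdinate n * (Real.log x))) +
          U / π * (if ((⌊x⌋₊ : ℕ) : ℝ) = x then ArithmeticFunction.vonMangoldt ⌊x⌋₊ else 0)| ≤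
        C * (x * (Real.log U ^ 2 + Real.log (1 + 1 / Real.log x)) * (1 + 1 / Real.log x) +
          x * Real.log (3 * x) ^ 2 + Real.log (3 * x) * min U (x / primePowDist x)))
    {j k : ℕ} (hj : 1 ≤ j) (hjk : j < k) {M : ℕ} (hM : 1 ≤ M) {T₂ : ℝ} (hT₂ : 1 ≤ T₂)
    (hkT : (k : ℝ) * (π * M) ≤ T₂) :
    1 / (Real.sqrt j * Real.sqrt k) *
        ∑ n ∈ (Finset.range (zetaZeroCount T₂)).filter (fun n ↦ (k : ℝ) * (π * M) ≤ zetaOrdinate n),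
          Real.cos (zetaOrdinate n * (Real.log k - Real.log j)) / zetaOrdinate n ^ 2 ≤
      5 * C * (1 + Real.log T₂) ^ 2 / (2 * (M : ℝ) ^ 2) * (1 / ((j : ℝ) * k)) := by
  have hπ := Real.pi_gt_three
  have hM1 : (1 : ℝ) ≤ M := by exact_mod_cast hM
  have hk2 : (2 : ℝ) ≤ k := by exact_mod_cast (show 2 ≤ k by omega)
  have hj1 : (1 : ℝ) ≤ j := by exact_mod_cast hj
  have hk0 : (0 : ℝ) < k := by linarith
  have hkj1 : (1 : ℝ) ≤ (k : ℝ) - j := by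
    have : (j : ℝ) + 1 ≤ k := by exact_mod_cast hjk
    linarith
  have hπM1 : 1 ≤ π * (M : ℝ) := by nlinarith
  set L : ℝ := 1 + Real.log T₂ with hL
  have hlogT : 0 ≤ Real.log T₂ := Real.log_nonneg hT₂
  have hkT₂ : (k : ℝ) ≤ T₂ := le_trans (by nlinarith [mul_le_mul_of_nonneg_left hπM1 hk0.le]) hkT
  -- the logarithms against `L`
  have hl1 : Real.log (1 + k) ≤ L := by
    have h1 : Real.log (1 + (k : ℝ)) ≤ Real.log (2 * T₂) := Real.log_le_log (by linarith) (by linarith)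
    have h2 : Real.log (2 * T₂) = Real.log 2 + Real.log T₂ := Real.log_mul (by norm_num) (by linarith)
    linarith [Real.log_two_lt_d9]
  have hl3 : Real.log (3 * k) ≤ 2 * L := by
    rw [Real.log_mul (by norm_num) hk0.ne']
    have : Real.log (k : ℝ) ≤ Real.log T₂ := Real.log_le_log hk0 hkT₂
    linarith [log_three_le_two]
  have hl30 : 0 ≤ Real.log (3 * (k : ℝ)) := Real.log_nonneg (by linarith)
  have hl10 : 0 ≤ Real.log (1 + (k : ℝ)) := Real.log_nonneg (by linarith)
  have hP0 : 0 ≤ 2 * (Real.log T₂ ^ 2 + Real.log (1 + k)) + Real.log (3 * k) ^ 2 := by positivity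
  have hPL : 2 * (Real.log T₂ ^ 2 + Real.log (1 + k)) + Real.log (3 * k) ^ 2 + Real.log (3 * k) ≤ 10 * L ^ 2 := by
    have hLT : Real.log T₂ ≤ L := by linarith
    have hL1 : 1 ≤ L := by linarith
    nlinarith
  have hD : 2 * ((k : ℝ) * M) ≤ (k : ℝ) * (π * M) - 1 := by
    have hkM : (2 : ℝ) ≤ k * M := by nlinarith
    have e : (k : ℝ) * (π * M) - 1 - 2 * ((k : ℝ) * M) = (k * M) * (π - 2) - 1 := by ring
    nlinarith [mul_le_mul hkM (show (1 : ℝ) ≤ π - 2 by linarith) (by norm_num) (by positivity)]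
  have h := pair_le hC hLG hj hjk hM hkT
  have hw0 : 0 ≤ 1 / (Real.sqrt j * Real.sqrt k) := by positivity
  exact (mul_le_mul_of_nonneg_left h hw0).trans (pair_algebra hC hP0 hl30 hj1 hkj1 hM1 hD hPL)

end Summit.RiemannHypothesis.RiemannHypothesis.Theorems.EtaLeadingQuarter.Zeros

end
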